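import Literature.MathematicalPhysics.QuantumFieldTheory.Balaban1983to89.T3AlphaInputsACSchemas
import Literature.MathematicalPhysics.QuantumFieldTheory.Balaban1983to89.T3MinimiserStabilityReduction

/-!
# Route `UnitScaleTilt` — crux K2 `HistoryTail` (stmt-QuantumFields-18916): A SECOND FREE DIAL OF THE (α) PACKAGE `AlphaInputsT3ACFull` —
# the weights of the NON-TRIVIAL region histories can be INFLATED by any `M(K, j) ≥ 1` without leaving the package or any of the four proposed
# S5-readiness clauses (R0 `TrivTerm`, R1 `WtAdm`, R2 `ZtermSize`, R6 `RegionsRule`), while the majorant `up_D` becomes `up + (M−1)·(up − trivial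
# term)`; hence every dilute-family / decoupling bound proved for ALL such data self-improves by arbitrary factors `1/M(K, j)` on its non-trivial
# part (support file; kernel form of the lead finding F-g3-1, evidence on the item)

Fleet lead `ym-ust-18916-p1` (gen 3), 2026-08-27.  The v5′ proposal's STUB 4 `stub_diluteFamilyGlobal` (064c15926725cd98, owner ADDENDUM 2) quantifies
«∃ ccol C γ₁, ∀ F γ, ∀ D W ε₀ C68 Cχ B₃, `AlphaInputsT3ACFull D W …` → `S5Ready D W …` → ∀ separated S, `∫_{E_S} up_D ≤ e^{−¼p²|S| + C·x·N_j³}·∫ low_D`»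
with the constants fixed BEFORE the datum.  THIS FILE proves, sorry-free and over the interface as landed (v1.3, p468120) — in the same spirit as
`HistoryTailAlphaFreeDial` (gen 2, p465732: the `Zterm` shift E1):

* §1 the dialled datum: `W_M` = `W` with `wt_M(r) := wt(r)` for the trivial region history and `M(K,j)·wt(r)` otherwise, `D_M` = `D` with
  `LF_M := LF + (M−1)·(LF − χ·e^{Φ(triv)})`; under `LFSum D W` and R0's first clause «`wt(trivReg) = χ`» (hypothesis `hwt`): **`lfSum_wtScale`**
  (`LFSum D_M W_M`), `up_wtScale` (`up_{D_M} = up_D + (M−1)·(up_D − e^{Zterm(triv)}·low_D)`), `low_wtScale` (`low_{D_M} = low_D`), `trivTerm_le_up`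
  (`e^{Zterm(triv)}·low_D ≤ up_D`: the trivial term is one of the non-negative terms of (41));
* §2 **`alphaInputsT3ACFull_wtScale`**: for `M ≥ 1`, `AlphaInputsT3ACFull D W b₀ p₀ ε₀ C68 Cχ B₃ → AlphaInputsT3ACFull D_M W_M b₀ p₀ ε₀ C68 Cχ B₃` with
  THE SAME constants — no clause of the package reads `LF`/`wt` except (41′) a.e. (only easier: `up_M ≥ up`), the integrability of `up`
  (`up_M = M·up − (M−1)·e^{Zterm(triv)}·low`) and `LFSum`/`NoTrivOnLarge` (2) (the trivial weight is untouched); and the four S5-readiness clause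
  BODIES transfer: `trivWt_wtScale` (R0 (1)), `wt_ne_zero_of_wtScale` (R1's support), and `zterm_wtScale` / `omega_wtScale` /
  `regularity68Levels_wtScale` — R0 (2)(3), R2, R6 and `Regularity68Levels` read only `Zterm`, `Ω`, `Λ`, `Umin`, `assemble`, `LargeP`, all of which the
  dial leaves definitionally unchanged;
* §3 **`diluteBoundAll_selfImproves_nontriv`**: consequently, if a numerator bound `∫_{E_S} up ≤ B(K, j, S)·∫ low` on the joint large-plaquette events
  `E_S = {V | ∀ q ∈ S, θBal(K−j) ≤ |V(∂q) − 1|}` holds beyond some height for ALL pairs `(D, W)` with the full package and ANY dial-invariant side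
  condition `X` containing «`wt(trivReg) = χ`», then for every such pair and every `M ≥ 1` the NON-TRIVIAL part obeys the bound divided by `M`:
  `∫_{E_S} (up − e^{Zterm(triv)}·low) ≤ (B/M)·∫ low`; and **`diluteBoundAll_selfImproves`**: if moreover `Cχ ≤ 1` then `χ = 0` on `E_S` for `S ≠ ∅`
  (`NoTrivOnLarge` (1)), so the WHOLE numerator obeys `∫_{E_S} up ≤ (B/M)·∫ low` for every `M(K, j) ≥ 1` — the ∀-form asserts its own improvement by
  arbitrary factors, i.e. it can only hold if `∫_{E_S} up_D` vanishes beyond some height for every honest datum with `Cχ ≤ 1` (pub-balaban3d's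
  `dataT3` has `Cχ = 1`), which by (41′) would make every `θBal`-large averaged plaquette a Gibbs-null event.  So the stub is unprovable from its
  hypotheses as they stand: nothing typed bounds the non-trivial fibre masses `Σ_{r ≠ triv} ∫ wt_r` or the number of region histories, and no CLAUSE
  can — the honest bound is the large-field resummation itself ([Balaban1985UV3] Thm 1 (5) p.256; the history sum converges only with its small
  factors (71)).

WHAT THIS IS NOT: no claim that the package is inconsistent or that Bałaban's expansion violates anything — the dial produces a DIFFERENT,
junk-inflated datum which the typed clauses cannot tell from an honest one.  No new definition (the dialled data are structure literals inline).

References: T. Bałaban, CMP 102 (1985) 255–275 [Balaban1985UV3] ((5) p.256, (41) p.266, (47) p.267, (71) p.273).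
-/

noncomputable section

open MeasureTheory
open Literature.MathematicalPhysics.QuantumFieldTheory.Balaban1983to89
open Literature.MathematicalPhysics.QuantumFieldTheory.Balaban1983to89.T3ContinuumYM3Torus
open Literature.MathematicalPhysics.QuantumFieldTheory.Balaban1983to89.T3UnitScaleTilt
open Literature.MathematicalPhysics.QuantumFieldTheory.Balaban1983to89.T3UnitLawDensityEML
open Literature.MathematicalPhysics.QuantumFieldTheory.Balaban1983to89.T3RestrictedUnitDensity
open Literature.MathematicalPhysics.QuantumFieldTheory.Balaban1983to89.T3AlphaInputsAC
open Literature.MathematicalPhysics.QuantumFieldTheory.Balaban1983to89.T3AlphaInputsACSchemas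
open Literature.MathematicalPhysics.QuantumFieldTheory.Balaban1983to89.B10Eq38TorusDomains (toFine omegaSeq collarPrinted cornerPts)

namespace Summit.QuantumFields.YangMills.Theorems.HistoryTailAlphaWeightDial

open Classical

variable {F : T3Family} {γ : ℝ}

/-! ## §1 The dialled datum: `LF_M = LF + (M−1)·(LF − trivial term)`, `wt_M = wt` on the trivial region history and `M·wt` elsewhere -/

/-- The fibre measure of (41) (product Haar of the levels `i < j`) is a probability measure. [folklore] -/
private theorem isProbabilityMeasure_fibre (K j : ℕ) :
    IsProbabilityMeasure (Measure.pi fun i : Fin j => fieldMeasure (F.P K) (i : ℕ) (Matrix.specialUnitaryGroup (Fin 2) ℂ)) := by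
  haveI : ∀ i : Fin j, IsProbabilityMeasure (fieldMeasure (F.P K) (i : ℕ) (Matrix.specialUnitaryGroup (Fin 2) ℂ)) :=
    fun i => Missing.isProbabilityMeasure_fieldMeasure (F.P K) i
  infer_instance

/-- **THE TRIVIAL TERM OF (41)**: under `LFSum` and R0's first clause «the trivial region history's weight is `χ_j`», the `r = trivReg` term of the
opened history functional at exponent `Φ` is `χ_j(W)·e^{Φ(triv)}` (the fibre measure is a probability measure). [cite: Balaban1985UV3, (41) p.266 and (47) p.267] -/
theorem trivTerm_eq {D : AlphaDataT3 F γ} {W : LFData D} (hLF : LFSum D W)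
    (hwt : ∀ K j v Wf, W.wt K j (W.trivReg K j) v Wf = D.χ K j Wf) (K j : ℕ)
    (Wf : GaugeField (F.P K) j (Matrix.specialUnitaryGroup (Fin 2) ℂ)) (Φ : D.Hist K j → ℝ) :
    ∫ v, W.wt K j (W.trivReg K j) v Wf * Real.exp (Φ (W.assemble K j (W.trivReg K j) v))
        ∂Measure.pi (fun i : Fin j => fieldMeasure (F.P K) (i : ℕ) (Matrix.specialUnitaryGroup (Fin 2) ℂ)) =
      D.χ K j Wf * Real.exp (Φ (D.triv K j)) := by
  haveI := isProbabilityMeasure_fibre (F := F) K j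
  simp only [hwt, hLF.2.1, integral_const, smul_eq_mul]
  simp

/-- **THE TRIVIAL TERM IS ONE OF THE NON-NEGATIVE TERMS OF (41)**: `χ_j(W)·e^{Φ(triv)} ≤ LF_j(W)[Φ]` under `LFSum` and «`wt(trivReg) = χ`».
[cite: Balaban1985UV3, (41) p.266] -/
theorem trivTerm_le_lf {D : AlphaDataT3 F γ} {W : LFData D} (hLF : LFSum D W)
    (hwt : ∀ K j v Wf, W.wt K j (W.trivReg K j) v Wf = D.χ K j Wf) (K j : ℕ)
    (Wf : GaugeField (F.P K) j (Matrix.specialUnitaryGroup (Fin 2) ℂ)) (Φ : D.Hist K j → ℝ) :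
    D.χ K j Wf * Real.exp (Φ (D.triv K j)) ≤ D.LF K j Wf Φ := by
  rw [hLF.2.2 K j Wf Φ, ← trivTerm_eq hLF hwt K j Wf Φ]
  letI := W.regFintype K j
  exact Finset.single_le_sum (f := fun r => ∫ v, W.wt K j r v Wf * Real.exp (Φ (W.assemble K j r v))
      ∂Measure.pi (fun i : Fin j => fieldMeasure (F.P K) (i : ℕ) (Matrix.specialUnitaryGroup (Fin 2) ℂ)))
    (fun r _ => integral_nonneg fun v => mul_nonneg (hLF.1 K j r v Wf) (Real.exp_nonneg _)) (Finset.mem_univ _)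

/-- **`LFSum` FOR THE DIALLED DATUM**: with `wt_M = wt` on `trivReg` and `M·wt` elsewhere (`M ≥ 0`), the opened sum is
`LF + (M−1)·(LF − χ·e^{Φ(triv)})`. [cite: Balaban1985UV3, (41) p.266] -/
theorem lfSum_wtScale {D : AlphaDataT3 F γ} {W : LFData D} (hLF : LFSum D W)
    (hwt : ∀ K j v Wf, W.wt K j (W.trivReg K j) v Wf = D.χ K j Wf) (M : ℕ → ℕ → ℝ) (hM : ∀ K j, 0 ≤ M K j) :
    LFSum ({ D with LF := fun K j Wf Φ => D.LF K j Wf Φ + (M K j - 1) * (D.LF K j Wf Φ - D.χ K j Wf * Real.exp (Φ (D.triv K j))) } :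
        AlphaDataT3 F γ)
      ⟨W.Reg, W.regFintype, W.trivReg, W.assemble,
        fun K j r v Wf => if r = W.trivReg K j then W.wt K j r v Wf else M K j * W.wt K j r v Wf, W.LargeP⟩ := by
  refine ⟨fun K j r v Wf => ?_, hLF.2.1, fun K j Wf Φ => ?_⟩
  · -- non-negativity of the dialled weight
    show 0 ≤ (if r = W.trivReg K j then W.wt K j r v Wf else M K j * W.wt K j r v Wf)
    split_ifs
    · exact hLF.1 K j r v Wf
    · exact mul_nonneg (hM K j) (hLF.1 K j r v Wf)
  · -- the opened sum
    letI := W.regFintype K j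
    show D.LF K j Wf Φ + (M K j - 1) * (D.LF K j Wf Φ - D.χ K j Wf * Real.exp (Φ (D.triv K j))) =
      ∑ r : W.Reg K j, ∫ v, (if r = W.trivReg K j then W.wt K j r v Wf else M K j * W.wt K j r v Wf) *
          Real.exp (Φ (W.assemble K j r v))
        ∂Measure.pi (fun i : Fin j => fieldMeasure (F.P K) (i : ℕ) (Matrix.specialUnitaryGroup (Fin 2) ℂ))
    set I : W.Reg K j → ℝ := fun r => ∫ v, W.wt K j r v Wf * Real.exp (Φ (W.assemble K j r v))
      ∂Measure.pi (fun i : Fin j => fieldMeasure (F.P K) (i : ℕ) (Matrix.specialUnitaryGroup (Fin 2) ℂ)) with hI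
    -- each term: `I r` on the trivial history, `M·I r` elsewhere, i.e. `I r + (M−1)·(I r − [r = triv]·I r)`
    have hterm : ∀ r : W.Reg K j,
        ∫ v, (if r = W.trivReg K j then W.wt K j r v Wf else M K j * W.wt K j r v Wf) * Real.exp (Φ (W.assemble K j r v))
          ∂Measure.pi (fun i : Fin j => fieldMeasure (F.P K) (i : ℕ) (Matrix.specialUnitaryGroup (Fin 2) ℂ)) =
        I r + (M K j - 1) * (I r - if r = W.trivReg K j then I r else 0) := by
      intro r
      by_cases hr : r = W.trivReg K j
      · simp only [hr, if_true, sub_self, mul_zero, add_zero, hI]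
      · simp only [hr, if_false, sub_zero, hI]
        have hfun : (fun v => M K j * W.wt K j r v Wf * Real.exp (Φ (W.assemble K j r v))) =
            fun v => M K j * (W.wt K j r v Wf * Real.exp (Φ (W.assemble K j r v))) := by
          funext v; ring
        rw [hfun, integral_const_mul]
        ring
    rw [Finset.sum_congr rfl fun r _ => hterm r, Finset.sum_add_distrib, ← Finset.mul_sum, Finset.sum_sub_distrib,
      Finset.sum_ite_eq' Finset.univ (W.trivReg K j) I, if_pos (Finset.mem_univ _)]
    have hsum : ∑ r : W.Reg K j, I r = D.LF K j Wf Φ := by rw [hLF.2.2 K j Wf Φ]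
    have htriv : I (W.trivReg K j) = D.χ K j Wf * Real.exp (Φ (D.triv K j)) := trivTerm_eq hLF hwt K j Wf Φ
    rw [hsum, htriv]

/-- **`up` OF THE DIALLED DATUM**: `up_{D_M} = up_D + (M−1)·(up_D − e^{Zterm(triv)}·low_D)` (definitional: `up = LF[−mainT + Pint + Zterm]`, and the
trivial term `χ·e^{−mainT(triv) + Pint(triv) + Zterm(triv)}` is `e^{Zterm(triv)}·low`). [cite: Balaban1985UV3, (41) p.266 and (47) p.267] -/
theorem up_wtScale (D : AlphaDataT3 F γ) (M : ℕ → ℕ → ℝ) (K j : ℕ) (Wf : GaugeField (F.P K) j (Matrix.specialUnitaryGroup (Fin 2) ℂ)) :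
    AlphaDataT3.up ({ D with LF := fun K j Wf Φ => D.LF K j Wf Φ + (M K j - 1) * (D.LF K j Wf Φ - D.χ K j Wf * Real.exp (Φ (D.triv K j))) } :
        AlphaDataT3 F γ) K j Wf =
      D.up K j Wf + (M K j - 1) * (D.up K j Wf - Real.exp (D.Zterm K j (D.triv K j)) * D.low K j Wf) := by
  show D.LF K j Wf _ + (M K j - 1) * (D.LF K j Wf _ - D.χ K j Wf * Real.exp _) = _
  unfold AlphaDataT3.up AlphaDataT3.low
  simp only [Real.exp_add]
  ring

/-- The minorant `low` of (47) does not read `LF` (definitional). [cite: Balaban1985UV3, (47) p.267] -/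
theorem low_wtScale (D : AlphaDataT3 F γ) (M : ℕ → ℕ → ℝ) (K j : ℕ) (Wf : GaugeField (F.P K) j (Matrix.specialUnitaryGroup (Fin 2) ℂ)) :
    AlphaDataT3.low ({ D with LF := fun K j Wf Φ => D.LF K j Wf Φ + (M K j - 1) * (D.LF K j Wf Φ - D.χ K j Wf * Real.exp (Φ (D.triv K j))) } :
        AlphaDataT3 F γ) K j Wf = D.low K j Wf := rfl

/-- **THE TRIVIAL TERM OF `up`**: `e^{Zterm(triv)}·low_D ≤ up_D` under `LFSum` and «`wt(trivReg) = χ`». [cite: Balaban1985UV3, (41) p.266 and (47) p.267] -/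
theorem trivTerm_le_up {D : AlphaDataT3 F γ} {W : LFData D} (hLF : LFSum D W)
    (hwt : ∀ K j v Wf, W.wt K j (W.trivReg K j) v Wf = D.χ K j Wf) (K j : ℕ)
    (Wf : GaugeField (F.P K) j (Matrix.specialUnitaryGroup (Fin 2) ℂ)) :
    Real.exp (D.Zterm K j (D.triv K j)) * D.low K j Wf ≤ D.up K j Wf := by
  have h := trivTerm_le_lf hLF hwt K j Wf (fun h => -(D.mainT K j h Wf) + D.Pint K j h Wf + D.Zterm K j h)
  unfold AlphaDataT3.up
  refine le_trans (le_of_eq ?_) h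
  unfold AlphaDataT3.low
  simp only [Real.exp_add]
  ring

/-- `up` of the dialled datum as a function. [cite: Balaban1985UV3, (41) p.266] -/
theorem up_wtScale_eq (D : AlphaDataT3 F γ) (M : ℕ → ℕ → ℝ) (K j : ℕ) :
    AlphaDataT3.up ({ D with LF := fun K j Wf Φ => D.LF K j Wf Φ + (M K j - 1) * (D.LF K j Wf Φ - D.χ K j Wf * Real.exp (Φ (D.triv K j))) } :
        AlphaDataT3 F γ) K j =
      fun Wf => M K j * D.up K j Wf - (M K j - 1) * Real.exp (D.Zterm K j (D.triv K j)) * D.low K j Wf := by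
  funext Wf
  rw [up_wtScale]
  ring

/-! ## §2 The package and the four S5-readiness clause bodies are blind to the dial -/

/-- **THE v1.3 PACKAGE `AlphaInputsT3AC` SURVIVES THE INFLATION OF THE NON-TRIVIAL WEIGHTS** (`M ≥ 1`; given `LFSum` and «`wt(trivReg) = χ`» for the
law of `up`): no clause reads `LF` except (41′) a.e. — only easier, `up_M − up = (M−1)·(up − trivial term) ≥ 0` — and the integrability of `up`
(`up_M = M·up − (M−1)·e^{Zterm(triv)}·low`). [cite: Balaban1985UV3, (41) p.266 and (47) p.267] -/
theorem alphaInputsT3AC_wtScale {D : AlphaDataT3 F γ} (W : LFData D) (hLF : LFSum D W)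
    (hwt : ∀ K j v Wf, W.wt K j (W.trivReg K j) v Wf = D.χ K j Wf) {b₀ p₀ ε₀ C68 : ℝ}
    (h : T3AlphaInputsACSchemas.AlphaInputsT3AC D b₀ p₀ ε₀ C68) (M : ℕ → ℕ → ℝ) (hM : ∀ K j, 1 ≤ M K j) :
    T3AlphaInputsACSchemas.AlphaInputsT3AC
      ({ D with LF := fun K j Wf Φ => D.LF K j Wf Φ + (M K j - 1) * (D.LF K j Wf Φ - D.χ K j Wf * Real.exp (Φ (D.triv K j))) } :
        AlphaDataT3 F γ) b₀ p₀ ε₀ C68 := by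
  obtain ⟨hloc, hsizes, hχ, henv, hrep, hmin, hanti⟩ := h
  refine ⟨hloc, hsizes, hχ, fun K j hj => ?_, hrep, hmin, hanti⟩
  obtain ⟨h41, h47, hlowI, hupI, hpos⟩ := henv K j hj
  refine ⟨?_, h47, hlowI, ?_, hpos⟩
  · -- (41′) a.e. for the dialled datum
    show ∀ᵐ W' ∂fieldMeasure (F.P K) j (Matrix.specialUnitaryGroup (Fin 2) ℂ),
      resDensity F γ K Set.univ j W' ≤ Real.exp (-(D.Ecst K j) + D.Rm K j) *
        AlphaDataT3.up ({ D with LF := fun K j Wf Φ => D.LF K j Wf Φ + (M K j - 1) * (D.LF K j Wf Φ - D.χ K j Wf * Real.exp (Φ (D.triv K j))) } : AlphaDataT3 F γ) K j W'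
    filter_upwards [h41] with W' h1
    rw [up_wtScale D M K j W']
    refine h1.trans (mul_le_mul_of_nonneg_left ?_ (Real.exp_nonneg _))
    have hnt : 0 ≤ D.up K j W' - Real.exp (D.Zterm K j (D.triv K j)) * D.low K j W' :=
      sub_nonneg.mpr (trivTerm_le_up hLF hwt K j W')
    have hM1 : 0 ≤ M K j - 1 := sub_nonneg.mpr (hM K j)
    nlinarith [mul_nonneg hM1 hnt]
  · -- integrability of `M·up − (M−1)·e^{Zterm(triv)}·low`
    show Integrable (AlphaDataT3.up ({ D with LF := fun K j Wf Φ => D.LF K j Wf Φ + (M K j - 1) * (D.LF K j Wf Φ - D.χ K j Wf * Real.exp (Φ (D.triv K j))) } : AlphaDataT3 F γ) K j)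
      (fieldMeasure (F.P K) j (Matrix.specialUnitaryGroup (Fin 2) ℂ))
    rw [up_wtScale_eq D M K j]
    exact ((hupI.const_mul (M K j)).sub (hlowI.const_mul ((M K j - 1) * Real.exp (D.Zterm K j (D.triv K j))))).congr
      (ae_of_all _ fun Wf => by simp only [Pi.sub_apply, mul_assoc])

/-- **THE FULL PACKAGE `AlphaInputsT3ACFull` SURVIVES THE INFLATION OF THE NON-TRIVIAL WEIGHTS** with THE SAME constants `(b₀, p₀, ε₀, C68, Cχ, B₃)`:
`LFSum` for the dialled pair (`lfSum_wtScale`), `LargePSpec`/`SmallFactor71` do not read `wt`/`LF`, `NoTrivOnLarge` (2) reads the trivial weight only,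
which is untouched.  The free dial E4 of finding F-g3-1. [cite: Balaban1985UV3, (41) p.266] -/
theorem alphaInputsT3ACFull_wtScale {D : AlphaDataT3 F γ} {W : LFData D} {b₀ p₀ ε₀ C68 Cχ B₃ : ℝ}
    (h : AlphaInputsT3ACFull D W b₀ p₀ ε₀ C68 Cχ B₃) (hwt : ∀ K j v Wf, W.wt K j (W.trivReg K j) v Wf = D.χ K j Wf)
    (M : ℕ → ℕ → ℝ) (hM : ∀ K j, 1 ≤ M K j) :
    AlphaInputsT3ACFull
      ({ D with LF := fun K j Wf Φ => D.LF K j Wf Φ + (M K j - 1) * (D.LF K j Wf Φ - D.χ K j Wf * Real.exp (Φ (D.triv K j))) } :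
        AlphaDataT3 F γ)
      ⟨W.Reg, W.regFintype, W.trivReg, W.assemble,
        fun K j r v Wf => if r = W.trivReg K j then W.wt K j r v Wf else M K j * W.wt K j r v Wf, W.LargeP⟩
      b₀ p₀ ε₀ C68 Cχ B₃ := by
  obtain ⟨hpack, hLF, hLP, hNT, hSF⟩ := h
  refine ⟨alphaInputsT3AC_wtScale W hLF hwt hpack M hM, lfSum_wtScale hLF hwt M fun K j => zero_le_one.trans (hM K j), hLP, ?_, hSF⟩
  -- `NoTrivOnLarge`: clause (1) reads `χ` only; clause (2) reads the trivial weight, which the dial leaves alone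
  intro K j Wf p hj
  refine ⟨(hNT K j Wf p hj).1, fun hp v => ?_⟩
  show (if W.trivReg K j = W.trivReg K j then W.wt K j (W.trivReg K j) v Wf else M K j * W.wt K j (W.trivReg K j) v Wf) = 0
  rw [if_pos rfl]
  exact (hNT K j Wf p hj).2 hp v

/-- R0 (1) «the trivial region history's weight is `χ_j`» transfers to the dialled pair (the trivial weight is untouched). [cite: Balaban1985UV3, (47) p.267] -/
theorem trivWt_wtScale {D : AlphaDataT3 F γ} {W : LFData D} (hwt : ∀ K j v Wf, W.wt K j (W.trivReg K j) v Wf = D.χ K j Wf)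
    (M : ℕ → ℕ → ℝ) (K j : ℕ) (v : (i : Fin j) → GaugeField (F.P K) i (Matrix.specialUnitaryGroup (Fin 2) ℂ))
    (Wf : GaugeField (F.P K) j (Matrix.specialUnitaryGroup (Fin 2) ℂ)) :
    (if W.trivReg K j = W.trivReg K j then W.wt K j (W.trivReg K j) v Wf else M K j * W.wt K j (W.trivReg K j) v Wf) = D.χ K j Wf := by
  rw [if_pos rfl, hwt]

/-- R1's support: a non-zero dialled weight is a non-zero original weight (any `M`), so «`wt ≠ 0 ⇒ Adm`» transfers. [cite: Balaban1985UV3, (40)-(41) p.266] -/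
theorem wt_ne_zero_of_wtScale {D : AlphaDataT3 F γ} {W : LFData D} (M : ℕ → ℕ → ℝ) (K j : ℕ) (r : W.Reg K j)
    (v : (i : Fin j) → GaugeField (F.P K) i (Matrix.specialUnitaryGroup (Fin 2) ℂ)) (Wf : GaugeField (F.P K) j (Matrix.specialUnitaryGroup (Fin 2) ℂ))
    (h : (if r = W.trivReg K j then W.wt K j r v Wf else M K j * W.wt K j r v Wf) ≠ 0) : W.wt K j r v Wf ≠ 0 := by
  intro h0
  apply h
  split_ifs
  · exact h0
  · rw [h0, mul_zero]

/-- R2 `ZtermSize` and R6 `RegionsRule` read the datum only through `Zterm` and `Ω` (and the opened functional through `assemble`, `LargeP`, which the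
dial copies): the dialled datum has THE SAME `Zterm` (definitional), so both clause bodies transfer by `id`. [cite: Balaban1985UV3, (41) p.266] -/
theorem zterm_wtScale (D : AlphaDataT3 F γ) (M : ℕ → ℕ → ℝ) :
    ({ D with LF := fun K j Wf Φ => D.LF K j Wf Φ + (M K j - 1) * (D.LF K j Wf Φ - D.χ K j Wf * Real.exp (Φ (D.triv K j))) } :
        AlphaDataT3 F γ).Zterm = D.Zterm := rfl

/-- … and THE SAME regions `Ω` (definitional). [cite: Balaban1985UV3, (38)-(39) p.266] -/
theorem omega_wtScale (D : AlphaDataT3 F γ) (M : ℕ → ℕ → ℝ) :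
    ({ D with LF := fun K j Wf Φ => D.LF K j Wf Φ + (M K j - 1) * (D.LF K j Wf Φ - D.χ K j Wf * Real.exp (Φ (D.triv K j))) } :
        AlphaDataT3 F γ).Ω = D.Ω := rfl

/-- `Regularity68Levels` transfers to the dialled datum: it reads `Hist`, `Adm`, `Λ`, `Umin` only (definitional). [cite: Balaban1985UV3, (68) p.273] -/
theorem regularity68Levels_wtScale {D : AlphaDataT3 F γ} (M : ℕ → ℕ → ℝ) {b₀ p₀ C68 : ℝ} (h : Regularity68Levels D b₀ p₀ C68) :
    Regularity68Levels
      ({ D with LF := fun K j Wf Φ => D.LF K j Wf Φ + (M K j - 1) * (D.LF K j Wf Φ - D.χ K j Wf * Real.exp (Φ (D.triv K j))) } :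
        AlphaDataT3 F γ) b₀ p₀ C68 :=
  h

/-! ## §3 Every ∀-form numerator bound on the joint large-plaquette events self-improves by arbitrary factors `1/M(K, j)` -/

/-- **SELF-IMPROVEMENT OF ∀-FORM DILUTE-FAMILY BOUNDS, NON-TRIVIAL PART** (the kernel form of F-g3-1): fix `(b₀, p₀, ε₀, C68, Cχ, B₃)`, a separation
predicate `Sep` and a bound `B(K, j, S)` (both fixed BEFORE the datum), and a side condition `X` on pairs `(D, W)` which contains «`wt(trivReg) = χ`» and
is INVARIANT under the dial (the four v5′ S5-readiness clauses are: §2).  If EVERY pair with `AlphaInputsT3ACFull … ∧ X` admits a height `j₀` beyond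
which `∫_{E_S} up_D ≤ B(K, j, S)·∫ low_D` for all `Sep`-families `S`, then for every such pair and every `M ≥ 1` there is a height beyond which the
NON-TRIVIAL part of the numerator obeys the bound DIVIDED BY `M`: `∫_{E_S} (up_D − e^{Zterm(triv)}·low_D) ≤ (B/M)·∫ low_D` — apply the hypothesis to the
dialled pair, whose numerator is `∫_{E_S} up + (M−1)·∫_{E_S}(up − trivial term)`. [cite: Balaban1985UV3, (41) p.266, (47) p.267 and (71) p.273] -/
theorem diluteBoundAll_selfImproves_nontriv {b₀ p₀ ε₀ C68 Cχ B₃ : ℝ}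
    (X : (D : AlphaDataT3 F γ) → LFData D → Prop)
    (hXwt : ∀ (D : AlphaDataT3 F γ) (W : LFData D), X D W → ∀ K j v Wf, W.wt K j (W.trivReg K j) v Wf = D.χ K j Wf)
    (hX : ∀ (D : AlphaDataT3 F γ) (W : LFData D) (M : ℕ → ℕ → ℝ), (∀ K j, 1 ≤ M K j) → X D W →
      X ({ D with LF := fun K j Wf Φ => D.LF K j Wf Φ + (M K j - 1) * (D.LF K j Wf Φ - D.χ K j Wf * Real.exp (Φ (D.triv K j))) } :
          AlphaDataT3 F γ)
        ⟨W.Reg, W.regFintype, W.trivReg, W.assemble,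
          fun K j r v Wf => if r = W.trivReg K j then W.wt K j r v Wf else M K j * W.wt K j r v Wf, W.LargeP⟩)
    (Sep : (K j : ℕ) → Finset (Plaq (F.P K) j) → Prop) (B : (K j : ℕ) → Finset (Plaq (F.P K) j) → ℝ)
    (hall : ∀ (D : AlphaDataT3 F γ) (W : LFData D), AlphaInputsT3ACFull D W b₀ p₀ ε₀ C68 Cχ B₃ → X D W →
      ∃ j₀ : ℕ, ∀ (K j : ℕ), j₀ < j → j ≤ K → ∀ S : Finset (Plaq (F.P K) j), Sep K j S →
        ∫ V in {V | ∀ q ∈ S, θBal F.L γ b₀ p₀ (K - j) ≤ GaugeGroup.dist1 (GaugeField.plaqHol V q)}, D.up K j V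
            ∂fieldMeasure (F.P K) j (Matrix.specialUnitaryGroup (Fin 2) ℂ) ≤
          B K j S * ∫ V, D.low K j V ∂fieldMeasure (F.P K) j (Matrix.specialUnitaryGroup (Fin 2) ℂ))
    (D : AlphaDataT3 F γ) (W : LFData D) (hD : AlphaInputsT3ACFull D W b₀ p₀ ε₀ C68 Cχ B₃) (hXD : X D W)
    (M : ℕ → ℕ → ℝ) (hM : ∀ K j, 1 ≤ M K j) :
    ∃ j₀ : ℕ, ∀ (K j : ℕ), j₀ < j → j ≤ K → ∀ S : Finset (Plaq (F.P K) j), Sep K j S →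
      ∫ V in {V | ∀ q ∈ S, θBal F.L γ b₀ p₀ (K - j) ≤ GaugeGroup.dist1 (GaugeField.plaqHol V q)},
          (D.up K j V - Real.exp (D.Zterm K j (D.triv K j)) * D.low K j V) ∂fieldMeasure (F.P K) j (Matrix.specialUnitaryGroup (Fin 2) ℂ) ≤
        (B K j S / M K j) * ∫ V, D.low K j V ∂fieldMeasure (F.P K) j (Matrix.specialUnitaryGroup (Fin 2) ℂ) := by
  have hwt := hXwt D W hXD
  obtain ⟨j₀, hb⟩ := hall _ _ (alphaInputsT3ACFull_wtScale hD hwt M hM) (hX D W M hM hXD)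
  refine ⟨j₀, fun K j hj hjK S hS => ?_⟩
  have h := hb K j hj hjK S hS
  set E : Set (GaugeField (F.P K) j (Matrix.specialUnitaryGroup (Fin 2) ℂ)) :=
    {V | ∀ q ∈ S, θBal F.L γ b₀ p₀ (K - j) ≤ GaugeGroup.dist1 (GaugeField.plaqHol V q)} with hE
  set μ := fieldMeasure (F.P K) j (Matrix.specialUnitaryGroup (Fin 2) ℂ) with hμ
  -- integrability of the pieces (from the package's `EnvelopeRegular`)
  obtain ⟨hlowI, hupI, hpos⟩ := hD.1.envelopeRegular hjK
  set T : GaugeField (F.P K) j (Matrix.specialUnitaryGroup (Fin 2) ℂ) → ℝ :=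
    fun V => Real.exp (D.Zterm K j (D.triv K j)) * D.low K j V with hT
  have hTI : Integrable T μ := hlowI.const_mul _
  have h1 : IntegrableOn (fun V => (M K j - 1) * (D.up K j V - T V)) E μ := ((hupI.sub hTI).const_mul (M K j - 1)).integrableOn
  have h2 : IntegrableOn (fun V => D.up K j V - T V) E μ := (hupI.sub hTI).integrableOn
  have h3 : IntegrableOn T E μ := hTI.integrableOn
  -- the dialled numerator, opened
  have hnum : ∫ V in E, AlphaDataT3.up ({ D with LF := fun K j Wf Φ => D.LF K j Wf Φ + (M K j - 1) * (D.LF K j Wf Φ - D.χ K j Wf * Real.exp (Φ (D.triv K j))) } : AlphaDataT3 F γ) K j V ∂μ =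
      ∫ V in E, D.up K j V ∂μ + (M K j - 1) * ∫ V in E, (D.up K j V - T V) ∂μ := by
    rw [← integral_const_mul, ← integral_add hupI.integrableOn h1]
    exact integral_congr_ae (ae_of_all _ fun V => by rw [up_wtScale])
  have hden : ∫ V, AlphaDataT3.low ({ D with LF := fun K j Wf Φ => D.LF K j Wf Φ + (M K j - 1) * (D.LF K j Wf Φ - D.χ K j Wf * Real.exp (Φ (D.triv K j))) } : AlphaDataT3 F γ) K j V ∂μ =
      ∫ V, D.low K j V ∂μ := rfl
  rw [hnum, hden] at h
  -- `∫_E up = ∫_E (up − T) + ∫_E T` with both parts non-negative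
  have hT0 : 0 ≤ ∫ V in E, T V ∂μ :=
    integral_nonneg fun V => mul_nonneg (Real.exp_nonneg _) (hD.1.low_nonneg K j V)
  have hsplit : ∫ V in E, D.up K j V ∂μ = ∫ V in E, (D.up K j V - T V) ∂μ + ∫ V in E, T V ∂μ := by
    rw [← integral_add h2 h3]
    exact integral_congr_ae (ae_of_all _ fun V => by ring)
  have hMpos : 0 < M K j := zero_lt_one.trans_le (hM K j)
  -- `M·∫_E (up − T) ≤ ∫_E up + (M−1)·∫_E (up − T) ≤ B·∫ low`
  have hmain : M K j * ∫ V in E, (D.up K j V - T V) ∂μ ≤ B K j S * ∫ V, D.low K j V ∂μ := by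
    have : M K j * ∫ V in E, (D.up K j V - T V) ∂μ ≤
        ∫ V in E, D.up K j V ∂μ + (M K j - 1) * ∫ V in E, (D.up K j V - T V) ∂μ := by
      rw [hsplit]; nlinarith
    exact this.trans h
  have hgoal : ∫ V in E, (D.up K j V - T V) ∂μ ≤ B K j S / M K j * ∫ V, D.low K j V ∂μ := by
    rw [div_mul_eq_mul_div, le_div_iff₀ hMpos]
    linarith [hmain, mul_comm (M K j) (∫ V in E, (D.up K j V - T V) ∂μ)]
  exact hgoal

/-- **SELF-IMPROVEMENT OF ∀-FORM DILUTE-FAMILY BOUNDS** (F-g3-1, the case `Cχ ≤ 1` — pub-balaban3d's `dataT3` has `Cχ = 1`): on a joint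
large-plaquette event `E_S` with `S ≠ ∅`, `NoTrivOnLarge` (1) kills `χ_j`, hence `low_D` and the trivial term, so the WHOLE numerator obeys the ∀-form
bound divided by any `M(K, j) ≥ 1`: `∫_{E_S} up_D ≤ (B/M)·∫ low_D`.  An ∀-form bound with constants fixed before the datum therefore holds only if
`∫_{E_S} up_D = 0` beyond some height for every honest datum — by (41′), only if every `θBal`-large averaged plaquette were a Gibbs-null event.
[cite: Balaban1985UV3, (41) p.266, (47) p.267 and (71) p.273] -/
theorem diluteBoundAll_selfImproves {b₀ p₀ ε₀ C68 Cχ B₃ : ℝ} (hCχ : Cχ ≤ 1) (hγ : 0 < γ) (hγ1 : γ ≤ 1) (hb₀ : 0 < b₀)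
    (X : (D : AlphaDataT3 F γ) → LFData D → Prop)
    (hXwt : ∀ (D : AlphaDataT3 F γ) (W : LFData D), X D W → ∀ K j v Wf, W.wt K j (W.trivReg K j) v Wf = D.χ K j Wf)
    (hX : ∀ (D : AlphaDataT3 F γ) (W : LFData D) (M : ℕ → ℕ → ℝ), (∀ K j, 1 ≤ M K j) → X D W →
      X ({ D with LF := fun K j Wf Φ => D.LF K j Wf Φ + (M K j - 1) * (D.LF K j Wf Φ - D.χ K j Wf * Real.exp (Φ (D.triv K j))) } :
          AlphaDataT3 F γ)
        ⟨W.Reg, W.regFintype, W.trivReg, W.assemble,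
          fun K j r v Wf => if r = W.trivReg K j then W.wt K j r v Wf else M K j * W.wt K j r v Wf, W.LargeP⟩)
    (Sep : (K j : ℕ) → Finset (Plaq (F.P K) j) → Prop) (B : (K j : ℕ) → Finset (Plaq (F.P K) j) → ℝ)
    (hall : ∀ (D : AlphaDataT3 F γ) (W : LFData D), AlphaInputsT3ACFull D W b₀ p₀ ε₀ C68 Cχ B₃ → X D W →
      ∃ j₀ : ℕ, ∀ (K j : ℕ), j₀ < j → j ≤ K → ∀ S : Finset (Plaq (F.P K) j), Sep K j S →
        ∫ V in {V | ∀ q ∈ S, θBal F.L γ b₀ p₀ (K - j) ≤ GaugeGroup.dist1 (GaugeField.plaqHol V q)}, D.up K j V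
            ∂fieldMeasure (F.P K) j (Matrix.specialUnitaryGroup (Fin 2) ℂ) ≤
          B K j S * ∫ V, D.low K j V ∂fieldMeasure (F.P K) j (Matrix.specialUnitaryGroup (Fin 2) ℂ))
    (D : AlphaDataT3 F γ) (W : LFData D) (hD : AlphaInputsT3ACFull D W b₀ p₀ ε₀ C68 Cχ B₃) (hXD : X D W)
    (M : ℕ → ℕ → ℝ) (hM : ∀ K j, 1 ≤ M K j) :
    ∃ j₀ : ℕ, ∀ (K j : ℕ), j₀ < j → j ≤ K → ∀ S : Finset (Plaq (F.P K) j), Sep K j S → S.Nonempty →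
      ∫ V in {V | ∀ q ∈ S, θBal F.L γ b₀ p₀ (K - j) ≤ GaugeGroup.dist1 (GaugeField.plaqHol V q)}, D.up K j V
          ∂fieldMeasure (F.P K) j (Matrix.specialUnitaryGroup (Fin 2) ℂ) ≤
        (B K j S / M K j) * ∫ V, D.low K j V ∂fieldMeasure (F.P K) j (Matrix.specialUnitaryGroup (Fin 2) ℂ) := by
  obtain ⟨j₀, hb⟩ := diluteBoundAll_selfImproves_nontriv X hXwt hX Sep B hall D W hD hXD M hM
  refine ⟨j₀, fun K j hj hjK S hS hne => ?_⟩
  have h := hb K j hj hjK S hS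
  -- on `E_S` the minorant vanishes: `χ = 0` at a `Cχ·θBal`-large plaquette, `Cχ ≤ 1`
  have hθ0 : 0 ≤ θBal F.L γ b₀ p₀ (K - j) := (T3MinimiserStabilityReduction.θBal_pos F.hL.2.le hγ hγ1 hb₀ p₀ (K - j)).le
  have hlow0 : ∀ V ∈ {V : GaugeField (F.P K) j (Matrix.specialUnitaryGroup (Fin 2) ℂ) |
      ∀ q ∈ S, θBal F.L γ b₀ p₀ (K - j) ≤ GaugeGroup.dist1 (GaugeField.plaqHol V q)}, D.low K j V = 0 := by
    intro V hV
    obtain ⟨q, hq⟩ := hne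
    have hχ : D.χ K j V = 0 :=
      (hD.2.2.2.1 K j V q hjK).1 ((mul_le_of_le_one_left hθ0 hCχ).trans (hV q hq))
    unfold AlphaDataT3.low
    rw [hχ, zero_mul]
  have hE : MeasurableSet {V : GaugeField (F.P K) j (Matrix.specialUnitaryGroup (Fin 2) ℂ) |
      ∀ q ∈ S, θBal F.L γ b₀ p₀ (K - j) ≤ GaugeGroup.dist1 (GaugeField.plaqHol V q)} := by
    have hEeq : {V : GaugeField (F.P K) j (Matrix.specialUnitaryGroup (Fin 2) ℂ) |
          ∀ q ∈ S, θBal F.L γ b₀ p₀ (K - j) ≤ GaugeGroup.dist1 (GaugeField.plaqHol V q)} =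
        ⋂ q ∈ S, {V | θBal F.L γ b₀ p₀ (K - j) ≤ GaugeGroup.dist1 (GaugeField.plaqHol V q)} := by
      ext V; simp
    rw [hEeq]
    exact S.measurableSet_biInter fun q _ =>
      measurableSet_le measurable_const (RegularGaugeGroup.measurable_dist1.comp (Missing.measurable_plaqHol q))
  have hrw : ∫ V in {V | ∀ q ∈ S, θBal F.L γ b₀ p₀ (K - j) ≤ GaugeGroup.dist1 (GaugeField.plaqHol V q)},
        (D.up K j V - Real.exp (D.Zterm K j (D.triv K j)) * D.low K j V) ∂fieldMeasure (F.P K) j (Matrix.specialUnitaryGroup (Fin 2) ℂ) =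
      ∫ V in {V | ∀ q ∈ S, θBal F.L γ b₀ p₀ (K - j) ≤ GaugeGroup.dist1 (GaugeField.plaqHol V q)}, D.up K j V
        ∂fieldMeasure (F.P K) j (Matrix.specialUnitaryGroup (Fin 2) ℂ) :=
    setIntegral_congr_fun hE fun V hV => by simp only [hlow0 V hV, mul_zero, sub_zero]
  rw [hrw] at h
  exact h

end Summit.QuantumFields.YangMills.Theorems.HistoryTailAlphaWeightDial

end
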